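/-
Origin: expansion seat `planner-pub-hodgecm-pv10-0`, handover #2 2026-08-18T03:47:54Z (`HOME/pub-hodgecm-pv10/lean/Pv10/CharExtensionN15.lean`, md5 e1093bbe, 359 lines);
landed by the gen-5 packager in gate run 20 REPLACES the earlier landed copy of `HodgeCM/PerL34/CharExtensionN15.lean` (verbatim).
-/
/-
Copyright: HodgeCM publication cell, unit pub-hodgecm-pv10 (DAG-NODE PROVER #10).
Origin: pub-hodgecm-pv10/lean/Pv10/CharExtensionN15.lean — node N15 (PerL v5 §3.2, tex ll. 304–314).
Suggested package target: `HodgeCM/PerL34/CharExtensionN15.lean`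
(namespace `HodgeCM.PerL34.CharExtensionN15`).
Imports: Mathlib + the LANDED `HodgeCM.PerL34.NoSmallSubgroups` (node N31g, same seat, gate run 18).
Independent of pv05's `CharExt.lean` (N30 engine), with
which §1–§2 overlap in content (divisibility of the circle, abstract extension, continuity from an open
subgroup) but not in names; no global instance is declared here, so the two files can coexist.
-/
import Mathlib.Algebra.Category.Grp.Injective
import Mathlib.Topology.Algebra.Nonarchimedean.Basic
import Mathlib.Analysis.SpecialFunctions.Complex.Circle
import Summits.HodgeConjecture.HodgeCM.PerL34.NoSmallSubgroups

/-!
# N15 — extension of unitary characters (PerL v5 §3.2, tex ll. 304–314)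

Verbatim tex (ll. 304–313; the parenthesis "(… exist: … (Pontryagin duality); …)" is this node):

> … and fix splitting characters $\mu_1,\dots,\mu_4$ of the prescribed infinity types with
> $\mu_1\mu_2=\mu_3\mu_4=\mu_W$ (unitary Hecke characters of $L$ with prescribed components
> $(z/|z|)^{m_b}$ at the complex places and prescribed restriction $\varepsilon_{L/L_0}^{m}$ to
> $\A^\times_{L_0}$, all $m_b\equiv m\bmod 2$, exist: the two prescriptions agree on
> $L^\times_\infty\cap\A^\times_{L_0}=L^\times_{0,\infty}$ and are trivial on
> $L^\times\cap\A^\times_{L_0}L^\times_\infty=L_0^\times$, so they define a unitary character of the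
> subgroup $B:=L^\times\A^\times_{L_0}L_\infty^\times/L^\times$ of $\A^\times_L/L^\times$; $B$ is closed,
> being the product of the closed subgroup $\A^\times_{L_0}L^\times/L^\times$ (the image of the idele class
> group of $L_0$, which injects continuously and properly: norm-one classes are compact and
> $|\cdot|_L=|\cdot|^2_{L_0}$ on $\A^\times_{L_0}$) and the compact image of
> $L^\times_\infty/L^\times_{0,\infty}\cong(\C^\times/\R^\times)^{[L_0:\Q]}$; so the character extends to
> $\A^\times_L/L^\times$ (Pontryagin duality); take $\mu_1,\mu_3,\mu_W$ this way and put
> $\mu_2:=\mu_W\mu_1^{-1}$, $\mu_4:=\mu_W\mu_3^{-1}$).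

In E4 below the hypothesis `hχ : Continuous χ` (continuity of the character so defined ON `B`, for the
subspace topology) is where the tex's closedness-of-`B` argument enters (local compactness of `B` and
the open mapping theorem for `C_{L_0} × L_∞^× → B`); it is an input here, not proved.

The carver's typed PRINT core (`Carver/PerL34/AllowedCore.lean`, `N15_core_charExtension`) is the
character-extension theorem for CLOSED subgroups of locally compact abelian groups
(Deitmar–Echterhoff, *Principles of Harmonic Analysis*, 2nd ed., Cor. 3.6.2; Hewitt–Ross I (24.12)).
Its proof needs Pontryagin duality / Peter–Weyl for LCA groups, which Mathlib does not have.

## What this file kernel-proves (no duality needed; LABEL: PROVED, Mathlib only)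

* §1 **E1, abstract groups.**  The circle group is divisible, hence Baer-injective over `ℤ`; a
  unitary character extends along any injective homomorphism of abelian groups, in particular from
  any subgroup; and the DESCENT form: if `χ : B →* S¹` is trivial on `B ∩ Γ`, it extends to a
  character of `G` trivial on `Γ` (`exists_circleChar_extension_trivialOn`).
* §2 **E2, open subgroups.**  A continuous unitary character of an OPEN subgroup of a topological
  abelian group extends continuously (`…_of_isOpen`).
* §3 **E3, nonarchimedean groups.**  If `G` is nonarchimedean (open subgroups form a basis of
  neighbourhoods of `1`: profinite groups, finite-idele groups, their quotients and closed subgroups),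
  a continuous unitary character of ANY subgroup `B ≤ G` extends continuously
  (`…_of_nonarchimedean`).  Mechanism = node N31g: the circle has no small subgroups, so `χ` is
  trivial on `B ∩ V` for an open subgroup `V`; descend (E1) modulo `V`; the result is constant on the
  open cosets of `V`, hence continuous.
* §4 **E4, the idele-class shape** (the input pv05's `CharExt.lean` docstring leaves to "the N15
  holder"): `B ≤ G`; topological groups `N`, `K` with homomorphisms `iN : N →* G` (image in `B`) and
  `iK : K →* G` such that `(n,k) ↦ iN n · iK k` carries neighbourhoods of `(1,1)` to neighbourhoods of `1`
  (for `G = C_L`: `N = L_∞^×`, `K = ∏_w 𝒪_w^×`; `L_∞^× × ∏ 𝒪_w^×` is open in `𝔸_L^×` and `𝔸_L^× → C_L`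
  is open).  SHARP FORM `…_of_nhds_mul_of_trivialOn`: if `χ ∘ iN` is continuous and `χ = 1` on
  `B ∩ iK(K')` for one open subgroup `K'` of `K`, then `χ` extends continuously to `G` (no continuity of
  `χ` on `B` assumed, none of `iN`, `iK`).  With `K` nonarchimedean the subgroup `K'` comes for free from
  continuity of `χ` on `B ∩ iK(K)` (`…_of_nhds_mul`, `…_of_isOpenMap_mul`, subgroup form
  `…_of_nhds_mul_subgroup`).  This is exactly the use at ll. 307–310, with the adelic facts left to
  vocabulary D3.
* §5 the N15-shaped closed statements that ARE proved (`N15_core_open_holds`,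
  `N15_core_nonarchimedean_holds`, `N15_core_discrete_holds`).

## What is NOT proved here (LABEL: remaining PRINT input toward `N15_core_charExtension`)

The general locally compact case with non-trivial connected component and `B` not reached by E2–E4
(e.g. `ℤ ≤ ℝ`): structure theory of LCA groups / Pontryagin duality (Deitmar–Echterhoff Cor. 3.6.2).
-/

set_option autoImplicit false

noncomputable section

open Filter Topology Function Set

namespace HodgeCM.PerL34.CharExtensionN15

/-! ## §1  E1 — the circle is Baer-injective over `ℤ`; abstract extension and descent -/

/-- The circle group (written additively) is divisible: `x ↦ e^{ix}` is a surjection from the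
divisible group `ℝ`.  (A `def`, not a global instance — pv05's `CharExt.lean` declares one.) -/
@[reducible] def divisibleByAdditiveCircle : DivisibleBy (Additive Circle) ℤ :=
  Function.Surjective.divisibleBy (f := Circle.expHom)
    (fun z => by
      obtain ⟨x, hx⟩ := Circle.exp_surjective (Additive.toMul z)
      exact ⟨x, by simpa [Circle.expHom] using congrArg Additive.ofMul hx⟩)
    (fun a n => map_zsmul Circle.expHom n a)

/-- Baer's criterion for the additive circle. -/
theorem baer_additiveCircle : Module.Baer ℤ (Additive Circle) :=
  @Module.Baer.of_divisible _ _ divisibleByAdditiveCircle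

/-- **E1.**  A unitary character extends along any injective homomorphism of abelian groups. -/
theorem exists_circleChar_extension_of_injective {A B : Type*} [CommGroup A] [CommGroup B]
    (f : A →* B) (hf : Injective f) (χ : A →* Circle) :
    ∃ χ' : B →* Circle, ∀ a : A, χ' (f a) = χ a := by
  obtain ⟨h, hh⟩ := baer_additiveCircle.extension_property_addMonoidHom
    (MonoidHom.toAdditive f) hf (MonoidHom.toAdditive χ)
  refine ⟨MonoidHom.toAdditive.symm h, fun a => ?_⟩
  have := DFunLike.congr_fun hh (Additive.ofMul a)
  simpa [MonoidHom.toAdditive] using congrArg Additive.toMul this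

/-- **E1, subgroup form.** -/
theorem exists_circleChar_extension {G : Type*} [CommGroup G] (B : Subgroup G)
    (χ : B →* Circle) : ∃ χ' : G →* Circle, ∀ b : B, χ' (b : G) = χ b :=
  exists_circleChar_extension_of_injective B.subtype B.subtype_injective χ

/-- **E1, descent form.**  If `χ : B →* S¹` is trivial on `B ∩ Γ`, it is the restriction of a
character of `G` that is trivial on `Γ`. -/
theorem exists_circleChar_extension_trivialOn {G : Type*} [CommGroup G] (B Γ : Subgroup G)
    (χ : B →* Circle) (hχ : ∀ b : B, (b : G) ∈ Γ → χ b = 1) :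
    ∃ χ' : G →* Circle, (∀ γ ∈ Γ, χ' γ = 1) ∧ ∀ b : B, χ' (b : G) = χ b := by
  let π : G →* G ⧸ Γ := QuotientGroup.mk' Γ
  let φ : B →* G ⧸ Γ := π.comp B.subtype
  have hφker : φ.ker ≤ χ.ker := by
    intro b hb
    rw [MonoidHom.mem_ker] at hb ⊢
    have hb' : (b : G) ∈ Γ := by
      rw [← QuotientGroup.ker_mk' Γ]
      exact hb
    exact hχ b hb'
  -- `χ` descends to `B ⧸ ker φ`, which embeds into `G ⧸ Γ`; extend there (E1) and pull back.
  let χK : B ⧸ φ.ker →* Circle := QuotientGroup.lift φ.ker χ hφker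
  let ι : B ⧸ φ.ker →* G ⧸ Γ := QuotientGroup.kerLift φ
  obtain ⟨χbar, hχbar⟩ :=
    exists_circleChar_extension_of_injective ι (QuotientGroup.kerLift_injective φ) χK
  refine ⟨χbar.comp π, fun γ hγ => ?_, fun b => ?_⟩
  · have : π γ = 1 := by
      rw [← MonoidHom.mem_ker, QuotientGroup.ker_mk']
      exact hγ
    simp [this]
  · have h1 : (χbar.comp π) (b : G) = χbar (ι (QuotientGroup.mk b)) := by
      simp [ι, φ, π, QuotientGroup.kerLift_mk]
    rw [h1, hχbar, show χK (QuotientGroup.mk b) = χ b from QuotientGroup.lift_mk' _ hφker b]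

/-! ## §2  E2 — extension from an open subgroup -/

section Open

variable {G : Type*} [CommGroup G] [TopologicalSpace G] [IsTopologicalGroup G]

/-- A homomorphism to the circle that agrees with a continuous character on an open subgroup is
continuous. -/
theorem continuous_of_eqOn_openSubgroup (H : Subgroup G) (hH : IsOpen (H : Set G))
    (χ : H →* Circle) (hχ : Continuous χ) (χ' : G →* Circle) (hext : ∀ h : H, χ' (h : G) = χ h) :
    Continuous χ' := by
  apply continuous_of_continuousAt_one χ'
  have hon : ContinuousOn χ' (H : Set G) := by
    rw [continuousOn_iff_continuous_restrict]
    have : (H : Set G).restrict χ' = fun h : H => χ h := funext fun h => hext h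
    rw [this]
    exact hχ
  exact hon.continuousAt (hH.mem_nhds H.one_mem)

/-- A homomorphism to the circle which is trivial on an open subgroup is continuous. -/
theorem continuous_of_trivial_on_openSubgroup (V : OpenSubgroup G) (χ' : G →* Circle)
    (hV : ∀ v ∈ (V : Set G), χ' v = 1) : Continuous χ' := by
  apply continuous_of_continuousAt_one χ'
  have hev : (fun g => χ' g) =ᶠ[𝓝 (1 : G)] fun _ => (1 : Circle) := by
    filter_upwards [V.isOpen.mem_nhds V.one_mem] with g hg
    exact hV g hg
  rw [ContinuousAt, map_one]
  exact tendsto_const_nhds.congr' hev.symm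

/-- **E2.**  A continuous unitary character of an OPEN subgroup of a topological abelian group
extends to a continuous unitary character of the group. -/
theorem exists_continuous_circleChar_extension_of_isOpen (H : Subgroup G)
    (hH : IsOpen (H : Set G)) (χ : H →* Circle) (hχ : Continuous χ) :
    ∃ χ' : G →* Circle, Continuous χ' ∧ ∀ h : H, χ' (h : G) = χ h := by
  obtain ⟨χ', hext⟩ := exists_circleChar_extension H χ
  exact ⟨χ', continuous_of_eqOn_openSubgroup H hH χ hχ χ' hext, hext⟩

end Open

/-! ## §3  E3 — nonarchimedean groups: extension from an arbitrary subgroup -/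

section Nonarchimedean

/-- No small subgroups, relative form: a continuous unitary character of a subgroup `B` of a
nonarchimedean group (not necessarily abelian) is trivial on `B ∩ V` for some open subgroup `V` of
the ambient group. -/
theorem exists_openSubgroup_trivialOn {G : Type*} [Group G] [TopologicalSpace G]
    [NonarchimedeanGroup G] (B : Subgroup G) (χ : B →* Circle) (hχ : Continuous χ) :
    ∃ V : OpenSubgroup G, ∀ b : B, (b : G) ∈ (V : Set G) → χ b = 1 := by
  obtain ⟨U, hU, hker⟩ := NoSmallSubgroups.exists_nhds_one_forall_subgroup_le_ker χ hχ
  rw [nhds_subtype_eq_comap] at hU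
  obtain ⟨U', hU', hsub⟩ := hU
  obtain ⟨V, hV⟩ := NonarchimedeanGroup.is_nonarchimedean U' (by simpa using hU')
  refine ⟨V, fun b hb => ?_⟩
  have hle : (V : Subgroup G).comap B.subtype ≤ χ.ker := by
    apply hker
    intro x hx
    exact hsub (hV hx)
  exact hle (show b ∈ (V : Subgroup G).comap B.subtype from hb)

variable {G : Type*} [CommGroup G] [TopologicalSpace G] [NonarchimedeanGroup G]

/-- **E3.**  In a nonarchimedean topological abelian group, a continuous unitary character of ANY
subgroup extends to a continuous unitary character of the group. -/
theorem exists_continuous_circleChar_extension_of_nonarchimedean (B : Subgroup G)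
    (χ : B →* Circle) (hχ : Continuous χ) :
    ∃ χ' : G →* Circle, Continuous χ' ∧ ∀ b : B, χ' (b : G) = χ b := by
  obtain ⟨V, hV⟩ := exists_openSubgroup_trivialOn B χ hχ
  obtain ⟨χ', htriv, hext⟩ := exists_circleChar_extension_trivialOn B (V : Subgroup G) χ hV
  exact ⟨χ', continuous_of_trivial_on_openSubgroup V χ' (fun v hv => htriv v hv), hext⟩

end Nonarchimedean

/-! ## §4  E4 — the idele-class shape (PerL ll. 307–310)

`G` any topological abelian group (think `C_L = 𝔸_L^×/L^×`), `B ≤ G` the subgroup carrying the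
prescribed character (think `L^×𝔸^×_{L_0}L^×_∞/L^×`), `N ≤ B` (think: the image of `L_∞^×`) and
`K ≤ G` nonarchimedean (think: the image of `∏_w 𝒪_w^×`), such that `N × K → G`, `(n,k) ↦ nk`, maps
neighbourhoods of `(1,1)` to neighbourhoods of `1` (for ideles: `L_∞^× × ∏_w 𝒪_w^×` is OPEN in
`𝔸_L^×` and `𝔸_L^× → C_L` is open).  No local compactness, closedness or Hausdorffness is used. -/

section IdeleShape

variable {G : Type*} [CommGroup G] [TopologicalSpace G] [IsTopologicalGroup G]
variable {N K : Type*} [Group N] [TopologicalSpace N] [Group K] [TopologicalSpace K]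

/-- **E4, sharp form.**  `B ≤ G`; `iN : N →* G` with image in `B` and `iK : K →* G` ANY homomorphisms
from topological groups (no continuity assumed) such that `(n,k) ↦ iN n · iK k : N × K → G` carries
neighbourhoods of `(1,1)` to neighbourhoods of `1`.  A unitary character `χ` of `B` whose pull-back to
`N` is continuous and which is trivial on `B ∩ iK(K')` for some open subgroup `K'` of `K` extends to a
continuous unitary character of `G` (and is therefore itself continuous on `B`).  No continuity of `χ`
on `B` is assumed: for `G = C_L`, `N = L_∞^×`, `K = ∏_w 𝒪_w^×`, the two hypotheses are "the `∞`-type is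
continuous" and "`χ = 1` on the classes of `B` meeting a small `∏_w U_w`", which is where the arithmetic
of ll. 308–310 enters. -/
theorem exists_continuous_circleChar_extension_of_nhds_mul_of_trivialOn (B : Subgroup G)
    (iN : N →* G) (iK : K →* G) (hNB : ∀ n, iN n ∈ B)
    (hm : ∀ s ∈ 𝓝 ((1 : N), (1 : K)), (fun p : N × K => iN p.1 * iK p.2) '' s ∈ 𝓝 (1 : G))
    (χ : B →* Circle) (hχN : Continuous fun n : N => χ ⟨iN n, hNB n⟩)
    (K' : OpenSubgroup K) (hK' : ∀ b : B, (b : G) ∈ (K' : Subgroup K).map iK → χ b = 1) :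
    ∃ χ' : G →* Circle, Continuous χ' ∧ ∀ b : B, χ' (b : G) = χ b := by
  -- (E1, descent): extend `χ` to an abstract character of `G` trivial on `iK(K')`.
  let Γ : Subgroup G := (K' : Subgroup K).map iK
  obtain ⟨χ', htriv, hext⟩ := exists_circleChar_extension_trivialOn B Γ χ hK'
  refine ⟨χ', ?_, hext⟩
  -- continuity at 1: near `1`, `g = iN n · iK k` with `n` near `1` and `k ∈ K'`.
  apply continuous_of_continuousAt_one χ'
  rw [ContinuousAt, map_one, tendsto_def]
  intro A hA
  -- the pull-back of `χ` to `N`, as a homomorphism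
  let χN : N →* Circle :=
    { toFun := fun n => χ ⟨iN n, hNB n⟩
      map_one' := by
        have : (⟨iN 1, hNB 1⟩ : B) = 1 := Subtype.ext (by simp)
        rw [this, map_one]
      map_mul' := fun x y => by
        have : (⟨iN (x * y), hNB (x * y)⟩ : B) = ⟨iN x, hNB x⟩ * ⟨iN y, hNB y⟩ :=
          Subtype.ext (by simp)
        rw [this, map_mul] }
  have hχN' : Continuous χN := hχN
  -- the neighbourhood `s = {(n,k) : χ n ∈ A, k ∈ K'}` of `(1,1)` in `N × K`
  let s : Set (N × K) := (fun p => χN p.1) ⁻¹' A ∩ (fun p => p.2) ⁻¹' (K' : Set K)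
  have hs : s ∈ 𝓝 ((1 : N), (1 : K)) := by
    refine Filter.inter_mem ?_ ?_
    · have hc : Continuous fun p : N × K => χN p.1 := hχN'.comp continuous_fst
      exact hc.continuousAt.preimage_mem_nhds (by simpa using hA)
    · exact continuous_snd.continuousAt.preimage_mem_nhds (K'.isOpen.mem_nhds K'.one_mem)
  refine Filter.mem_of_superset (hm s hs) ?_
  rintro g ⟨⟨n, k⟩, ⟨hnA, hkK'⟩, rfl⟩
  -- `χ' (iN n · iK k) = χ' (iN n) · χ' (iK k) = χ n · 1`
  have hn : χ' (iN n) = χN n := hext ⟨iN n, hNB n⟩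
  have hk : χ' (iK k) = 1 := htriv _ (Subgroup.mem_map.mpr ⟨k, hkK', rfl⟩)
  show χ' (iN n * iK k) ∈ A
  rw [map_mul, hn, hk, mul_one]
  exact hnA

/-- **E4.**  The same with `K` NONARCHIMEDEAN and `χ` continuous on `B ∩ iK(K)` (pulled back to `K`):
then the open subgroup `K'` of the sharp form exists by node N31g (no small subgroups). -/
theorem exists_continuous_circleChar_extension_of_nhds_mul [NonarchimedeanGroup K] (B : Subgroup G)
    (iN : N →* G) (iK : K →* G) (hNB : ∀ n, iN n ∈ B)
    (hm : ∀ s ∈ 𝓝 ((1 : N), (1 : K)), (fun p : N × K => iN p.1 * iK p.2) '' s ∈ 𝓝 (1 : G))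
    (χ : B →* Circle) (hχN : Continuous fun n : N => χ ⟨iN n, hNB n⟩)
    (hχK : Continuous fun k : B.comap iK => χ ⟨iK k, k.2⟩) :
    ∃ χ' : G →* Circle, Continuous χ' ∧ ∀ b : B, χ' (b : G) = χ b := by
  -- (no small subgroups inside `K`): an open subgroup `K'` of `K` with `χ = 1` on `B ∩ iK(K')`.
  let BK : Subgroup K := B.comap iK
  let χK : BK →* Circle := χ.comp (iK.subgroupComap B)
  have hχK' : Continuous χK := hχK
  obtain ⟨K', hK'⟩ := exists_openSubgroup_trivialOn (G := K) BK χK hχK'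
  have hχΓ : ∀ b : B, (b : G) ∈ (K' : Subgroup K).map iK → χ b = 1 := by
    intro b hb
    obtain ⟨k, hk, hkb⟩ := Subgroup.mem_map.mp hb
    have hkB : iK k ∈ B := by rw [hkb]; exact b.2
    have h := hK' ⟨k, hkB⟩ hk
    have heq : χK ⟨k, hkB⟩ = χ b := by
      show χ ((iK.subgroupComap B) ⟨k, hkB⟩) = χ b
      congr 1
      exact Subtype.ext hkb
    rw [heq] at h
    exact h
  exact exists_continuous_circleChar_extension_of_nhds_mul_of_trivialOn B iN iK hNB hm χ hχN K' hχΓ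

/-- **E4, subgroup form.**  `N ≤ B` and `K ≤ G` subgroups (subspace topologies), `K` nonarchimedean,
`(n,k) ↦ nk` open at `(1,1)`, `χ` continuous on `B`. -/
theorem exists_continuous_circleChar_extension_of_nhds_mul_subgroup (B N₀ K₀ : Subgroup G)
    (hNB : N₀ ≤ B) [NonarchimedeanGroup K₀]
    (hm : ∀ s ∈ 𝓝 ((1 : N₀), (1 : K₀)), (fun p : N₀ × K₀ => (p.1 : G) * (p.2 : G)) '' s ∈ 𝓝 (1 : G))
    (χ : B →* Circle) (hχ : Continuous χ) :
    ∃ χ' : G →* Circle, Continuous χ' ∧ ∀ b : B, χ' (b : G) = χ b := by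
  refine exists_continuous_circleChar_extension_of_nhds_mul B N₀.subtype K₀.subtype
    (fun n => hNB n.2) (by simpa using hm) χ ?_ ?_
  · exact hχ.comp (by exact Continuous.subtype_mk continuous_subtype_val _)
  · exact hχ.comp (by
      exact Continuous.subtype_mk (continuous_subtype_val.comp continuous_subtype_val) _)

/-- **E4, open-map form**: `iN × iK` followed by multiplication is an OPEN MAP `N × K → G` (for ideles:
`L_∞^× × ∏_w 𝒪_w^×` is open in `𝔸_L^×` and `𝔸_L^× → C_L` is open), `K` nonarchimedean. -/
theorem exists_continuous_circleChar_extension_of_isOpenMap_mul [NonarchimedeanGroup K]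
    (B : Subgroup G) (iN : N →* G) (iK : K →* G) (hNB : ∀ n, iN n ∈ B)
    (hm : IsOpenMap fun p : N × K => iN p.1 * iK p.2)
    (χ : B →* Circle) (hχN : Continuous fun n : N => χ ⟨iN n, hNB n⟩)
    (hχK : Continuous fun k : B.comap iK => χ ⟨iK k, k.2⟩) :
    ∃ χ' : G →* Circle, Continuous χ' ∧ ∀ b : B, χ' (b : G) = χ b :=
  exists_continuous_circleChar_extension_of_nhds_mul B iN iK hNB
    (fun s hs => by simpa using hm.image_mem_nhds hs) χ hχN hχK

end IdeleShape

/-! ## §5  The N15-shaped closed statements that ARE proved -/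

/-- `N15_core` with "closed" replaced by "open": PROVED (E2). -/
theorem N15_core_open_holds :
    ∀ (G : Type) [CommGroup G] [TopologicalSpace G] [IsTopologicalGroup G]
      (B : Subgroup G), IsOpen (B : Set G) →
      ∀ χ : B →* Circle, Continuous χ →
        ∃ χ' : G →* Circle, Continuous χ' ∧ ∀ b : B, χ' (b : G) = χ b :=
  fun _ _ _ _ B hB χ hχ => exists_continuous_circleChar_extension_of_isOpen B hB χ hχ

/-- `N15_core` for nonarchimedean groups and ARBITRARY subgroups (closedness not needed): PROVED
(E3). -/
theorem N15_core_nonarchimedean_holds :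
    ∀ (G : Type) [CommGroup G] [TopologicalSpace G] [NonarchimedeanGroup G]
      (B : Subgroup G) (χ : B →* Circle), Continuous χ →
        ∃ χ' : G →* Circle, Continuous χ' ∧ ∀ b : B, χ' (b : G) = χ b :=
  fun _ _ _ _ B χ hχ => exists_continuous_circleChar_extension_of_nonarchimedean B χ hχ

/-- `N15_core` for discrete groups (every character is continuous): PROVED (E1). -/
theorem N15_core_discrete_holds :
    ∀ (G : Type) [CommGroup G] [TopologicalSpace G] [DiscreteTopology G]
      (B : Subgroup G) (χ : B →* Circle),
        ∃ χ' : G →* Circle, Continuous χ' ∧ ∀ b : B, χ' (b : G) = χ b :=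
  fun _ _ _ _ B χ => by
    obtain ⟨χ', h⟩ := exists_circleChar_extension B χ
    exact ⟨χ', continuous_of_discreteTopology, h⟩

end HodgeCM.PerL34.CharExtensionN15

end
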